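import Summits.QuantumFields.YangMills.Theorems.UnitScaleTiltProp7TwistedLevelMassOfRegPr
import Summits.QuantumFields.YangMills.Theorems.UnitScaleTiltProp7Chart48SymUntwisted
import Summits.QuantumFields.YangMills.Theorems.UnitScaleTiltProp7SymAvgTwSymDefs
import HarnessLib

/-!
# Route `UnitScaleTilt`, crux K1 «MinimiserStabilityRegPr» (stmt-QuantumFields-19200), route-R E′ (A′)-on-Σ, P-A2 — file «F3″-Φˢ-EXPORT»:
# **THE ACCUMULATED SYMMETRIC FRAME MASSES `Φˢ_l = Σ_x ‖v_l(x) − 1‖²` IN THE `ℓ⁻¹M₀ + ℓ·KD` CURRENCY, AT EVERY LEVEL AND AT THE TOP (`frameTwS`), AT THE Σ∕E2E DATUM**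

Cell `ym3-torus` (HUMAN RULING D-0037: YM₃ on the torus is ladder rung R3 — not d = 4, not a mass gap, not Clay), width seat `ym3-torus-px16` (gen 5), LOCATE
`LOCATE-R0-FRAME-RATIO-px16g5.md` (19200 evidence #53) §3 («Φˢ_top export», the symmetric half of the frame-ratio mass `Σ_y‖g(y) − 1‖² ≤ 2.2(Φᶜ_top + Φˢ_top)` of the (β) row).
`--supports stmt-QuantumFields-19200 --as helper`; THEOREMS ONLY (0 `def`, 0 `sorry`); count-neutral.  A knit of landed rows (px17 g3's F3″-C2∕C3, px22 g3's F3″-A∕B, (n3));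
no estimate of print asserted beyond them; nothing of (β), `hPA2`, `hcoS`, E′, EX, the crux, d = 4 or the gap is claimed.

THE PRINT.  [Balaban1985Averaging] (82) p. 30 (block frames), (97) p. 32 (accumulation `v_{j+1}(y) = v_j(y)·w_j(y)`), Prop. 3 (122)–(126) p. 36; [Balaban1984PropagatorsI] (1.18)–(1.20)
pp. 19–20 (the multiscale split of a bond field's mass).

WHY.  F3″ (✓`Prop7TwistedLevelMassT3`) bounds the masses of the TWISTED LINKS `V^{(l)}·Ū₀^{(l)⁻¹}`; its engine is the accumulated-frame mass recursion ✓`frameMass_recursion_T3`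
(`Φ_{l+1} ≤ (4L⁻³ + (18L)⁻¹)·Φ_l + 40L²·M^{sb}_l`) solved by ✓`frameMass_induction` — but the FRAME masses themselves are consumed inside and never exported.  The (β) row of ★p1 g18's
P-A2 assembler (`Σ_ĉ‖CmapTw − CmapTwS‖ ≤ CD₁ℓ⁻¹M + CD₂ℓ(K + DIV)`) needs them at the top level: the sup windows (Rp) of ✓`Prop7CombSymBCHDoor`∕✓`Prop7CombSymR12OfSiteRow` enter squared and
summed (`Σ_y p(y)²`), and `‖g(y) − 1‖ ≤ ‖w_c(y)⁻¹ − 1‖ + ‖w_s(y) − 1‖ + product`, `w_s = frameTwS`.  This file exports `Φˢ_l ≤ 560L³·M₀·(Lˡ)⁻¹ + 40L²·(28800L⁴·KD + 600000L⁴·ℓ⁻²·M₀)·Lˡ`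
for every `l ≤ K − n` (guards displayed ∕ guards discharged ∕ at the member) and reads the top level `l = K − n` as `Σ_{y : Site (F.P n) 0} ‖↑(frameTwS W (I•D) y) − 1‖²`.

WHAT IS PROVED (ns `…Theorems.Prop7SymFrameMassOfRegPr`; T³, `SU(2)`).
* §1 ★★ `sum_normSq_frameAccU_sub_one_le_LOnly_T3_of_guards` ∕ ★★ `…_T3` — (n3)'s binders VERBATIM (+ the (0.4) guards, then discharged by ✓px22 `small_iter_background_T3'`∕`small_iter_competitor_T3`):
  `∀ l ≤ K − n, Σ_{x : Site (F.P K) l} ‖↑(frameAccU l U₀♭ W♭ x) − 1‖² ≤ 2L·40L²·(7·M₀·(Lˡ)⁻¹) + 40L²·((28800L⁴·KD + 600000L⁴·ℓ⁻²·M₀)·Lˡ)`.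
* §2 ★★ `sum_normSq_frameAccU_sub_one_le_of_regPr` — the same at the Σ∕E2E datum (`RegPr F n K e W`, `D` Hermitian traceless, `‖D b‖ ≤ s`, windows `10¹⁴L⁹e ≤ 1`, `4s ≤ 1`,
  `4·10¹¹L⁹(ℓs) ≤ 1` — ✓px17 `chartSups`∕`supNumerals` VERBATIM), competitor `emb15 W (expHermField D)`.
* §3 ★★★ `sum_normSq_frameTwS_sub_one_le_of_regPr` — THE TOP LEVEL IN THE (β) DOOR'S LETTERS: `Σ_{y : Site (F.P n) 0} ‖↑(frameTwS F n K h W (fun b ↦ I•D b) y) − 1‖² ≤ (same at l = K − n)`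
  (re-indexing along lit `siteShift (sites_eq F n K h)`, `frameTwS_def`, ✓`unitsField_toUField_emb15_expHermField`).
HONEST SCOPE.  Composition + real arithmetic over landed theorems; constants not optimised; the COMB half `Φᶜ_top` is NOT here (LOCATE #53∕#54: needs print's comb-tower level masses, XL).

References: T. Bałaban, CMP **98** (1985) 17–51 [Balaban1985Averaging] ((82) p.30, (89) p.31, (97) p.32, Prop. 3 (122)–(126) p.36, Prop. 4 (134)–(135) p.38); CMP **95** (1984) 17–40
[Balaban1984PropagatorsI] ((1.18)–(1.20) pp.19–20); CMP **102** (1985) 277–309 [Balaban1985Variational] ((14)–(15) p.280, (44) p.285, Prop. 7 p.299); CMP **109** (1987) 249–301 [Balaban1987RG1] ((0.4), (0.11) p.253).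
-/

set_option autoImplicit false

noncomputable section

open scoped BigOperators Matrix.Norms.L2Operator Matrix

namespace Summit.QuantumFields.YangMills.Theorems.Prop7SymFrameMassOfRegPr

open Finset
open Literature.MathematicalPhysics.QuantumFieldTheory.Balaban1983to89
open Literature.MathematicalPhysics.QuantumFieldTheory.Balaban1983to89.T3ContinuumYM3Torus
open Literature.MathematicalPhysics.QuantumFieldTheory.Balaban1983to89.T3PrintedRegularMinimiser (RegPr)
open Literature.MathematicalPhysics.QuantumFieldTheory.Balaban1983to89.T3SectALandauChart (emb15 bgUnits)
open T4Continuum BlockAveraging AveragingRT ExpMeanLog BlockAveragingEMLLinearised BlockAveragingEMLLinearisedBackground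
open B9Eq39Adjoint (curl divB)
open B10Eq27TorusAxialLog (unitsField toUField)
open B9TorusCalculus (torusT)
open B7Prop1Explicit (expUnit)
open T3LevelShift (siteShift)
open T3PrintedRegularOrbits (sites_eq)
open Summit.QuantumFields.YangMills.Theorems.Prop7TPrint (expHermField)
open Summit.QuantumFields.YangMills.Theorems.Prop7SymAvgTwSym (frameAccU frameAccU_zero frameTwS frameTwS_def)
open Summit.QuantumFields.YangMills.Theorems.Prop7TwistedLevelMassT3 (frameMass_recursion_T3)
open Summit.QuantumFields.YangMills.Theorems.Prop7TwistedLevelMassInduction (frameMass_induction)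
open Summit.QuantumFields.YangMills.Theorems.Prop7CompetitorGuardOfLevelSups (small_iter_competitor_T3 small_iter_background_T3')
open Summit.QuantumFields.YangMills.Theorems.Prop7JointRowTowerData (chartSups supNumerals)
open Summit.QuantumFields.YangMills.Theorems.Prop7TwistedLevelMassOfRegPr (plaq_le_of_regPr window_weak)
open Summit.QuantumFields.YangMills.Theorems.Prop7Chart48SymUntwisted (unitsField_toUField_emb15_expHermField)

section T3

variable (F : T3Family) (n K : ℕ)

/-! ## §1 The accumulated-frame masses at every level, (n3)'s binders + guards -/

/-- ★★ **THE ACCUMULATED SYMMETRIC FRAME MASSES, GUARDS DISPLAYED** (d = 3, `SU(2)`): under (n3) ✓`sum_normSq_levelRatio_le_LOnly_T3`'s binders VERBATIM plus the (0.4) guards of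
both towers, for every `l ≤ K − n`, `Φˢ_l := Σ_{x : Site (F.P K) l} ‖v_l(x) − 1‖²` (`v_l = frameAccU l U₀♭ W♭`) satisfies
`Φˢ_l ≤ 2L·40L²·(7·M₀·(Lˡ)⁻¹) + 40L²·((28800L⁴·(CURL + DIV) + 600000L⁴·ℓ⁻²·M₀)·Lˡ)` — ✓`frameMass_induction` ∘ ✓`frameMass_recursion_T3` ∘ (n3). [cite: Balaban1985Averaging, (97) p.32, Prop. 3 (122)-(126) p.36; Balaban1984PropagatorsI, (1.18)-(1.20) pp.19-20] -/
theorem sum_normSq_frameAccU_sub_one_le_LOnly_T3_of_guards (U₀ W : GaugeField (F.P K) 0 (Matrix.specialUnitaryGroup (Fin 2) ℂ)) {ε : ℝ} (hε : 0 < ε) (hεL : 1000000 * (F.L : ℝ) ^ 5 * ε ≤ 1)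
    (hU : ∀ p : Plaq (F.P K) 0, dist1 (GaugeField.plaqHol U₀ p) ≤ ε * (((F.L : ℝ) ^ (K - n)) ^ 2)⁻¹)
    (hU₀g : ∀ i, i < K - n → ∀ c : PBond (F.P K) (i + 1), Small (expMeanLogSU (n := Fin 2)) (Averaging.iter (fun j => blockAvg (P := F.P K) (j := j) (expMeanLogSU (n := Fin 2))) i U₀) c)
    (hWg : ∀ i, i < K - n → ∀ c : PBond (F.P K) (i + 1), Small (expMeanLogSU (n := Fin 2)) (Averaging.iter (fun j => blockAvg (P := F.P K) (j := j) (expMeanLogSU (n := Fin 2))) i W) c)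
    (μ : ℕ → ℝ) (hμ0 : ∀ j < K - n, 0 ≤ μ j)
    (hμ : ∀ j < K - n, ∀ c : PBond (F.P K) (j + 1), ((((F.P K).d + 2) * (F.P K).L : ℕ) : ℝ) * ∑ b ∈ (univ.filter (fun b : PBond (F.P K) j => blockOf b.src = c.src ∨ blockOf b.src = c.tgt)), ‖(pertVar (Averaging.iter (fun i => blockAvg (P := (F.P K)) (j := i) (expMeanLogSU (n := Fin 2))) j U₀) (Averaging.iter (fun i => blockAvg (P := (F.P K)) (j := i) (expMeanLogSU (n := Fin 2))) j W)) b‖ ≤ μ j)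
    (hμ72 : ∀ j < K - n, 72 * μ j ≤ 1) (hμN : ∀ j < K - n, 3 * μ j + 1 / 24 < deltaSU (Fin 2))
    {θ : ℝ} (hθ0 : 0 ≤ θ) (hμθ : ∀ j < K - n, 7800 * (F.L : ℝ) ^ 3 * (F.L : ℝ) ^ (K - n) * μ j ≤ θ * (F.L : ℝ) ^ j)
    (hθL : 1000 * θ * (F.L : ℝ) ≤ 1) :
    ∀ l ≤ K - n, ∑ x : Site (F.P K) l, ‖((frameAccU l (unitsField (toUField U₀)) (unitsField (toUField W)) x : (Matrix (Fin 2) (Fin 2) ℂ)ˣ) : Matrix (Fin 2) (Fin 2) ℂ) - 1‖ ^ 2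
      ≤ 2 * (F.L : ℝ) * (40 * (F.L : ℝ) ^ 2) * (7 * (∑ b : PBond (F.P K) 0, ‖pertVar U₀ W b‖ ^ 2) * ((F.L : ℝ) ^ l)⁻¹)
        + 40 * (F.L : ℝ) ^ 2 * ((28800 * (F.L : ℝ) ^ 4 * ((∑ x : Site (F.P K) 0, ∑ μ : Fin (F.P K).d, ∑ ν : Fin (F.P K).d,
            (if μ < ν then ∑ j : Fin 2, ∑ k : Fin 2,
              ‖(curl (torusT (F.P K) 0) (fun κ z => unitsField (toUField U₀) ⟨z, κ⟩) (fun κ z => pertVar U₀ W ⟨z, κ⟩) μ ν x) j k‖ ^ 2 else 0)) + (∑ x : Site (F.P K) 0, ∑ j : Fin 2, ∑ k : Fin 2,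
            ‖(divB (torusT (F.P K) 0) (fun κ z => unitsField (toUField U₀) ⟨z, κ⟩) (fun κ z => pertVar U₀ W ⟨z, κ⟩) x) j k‖ ^ 2))
            + 600000 * (F.L : ℝ) ^ 4 * (((F.L : ℝ) ^ (K - n)) ^ 2)⁻¹ * (∑ b : PBond (F.P K) 0, ‖pertVar U₀ W b‖ ^ 2)) * (F.L : ℝ) ^ l) := by
  have hL3 : (3 : ℝ) ≤ F.L := Prop7CurvedLandauKnitT3.three_le_L F
  have hL0 : (0 : ℝ) < F.L := by linarith
  -- (n3): the single-bar level masses; F3″-C3 §4: the `Φ`-recursion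
  have hM := Prop7FibreLevelMassPerLevelT3.sum_normSq_levelRatio_le_LOnly_T3 F n K U₀ W hε hεL hU μ hμ0 hμ hμ72 hμN hθ0 hμθ hθL
  have hΦ := frameMass_recursion_T3 F n K U₀ W hU₀g hWg μ hμ hμ72 hθ0 hμθ hθL
  -- F3″-A: the induction, at `q = 4L⁻³ + (18L)⁻¹`, `C = 40L²`, `A = 7`
  have hq : (0 : ℝ) ≤ 4 * ((F.L : ℝ) ^ 3)⁻¹ + (18 * (F.L : ℝ))⁻¹ := by positivity
  have hqL : (4 * ((F.L : ℝ) ^ 3)⁻¹ + (18 * (F.L : ℝ))⁻¹) * (F.L : ℝ) ≤ 1 / 2 := by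
    have hA : ((F.L : ℝ) ^ 3)⁻¹ * (F.L : ℝ) ≤ 1 / 9 := by
      rw [inv_mul_le_iff₀ (by positivity)]
      have hL9 : (9 : ℝ) ≤ (F.L : ℝ) ^ 2 := by nlinarith
      have e3 : (F.L : ℝ) ^ 3 = (F.L : ℝ) ^ 2 * (F.L : ℝ) := by ring
      rw [e3]
      nlinarith
    have hB : (18 * (F.L : ℝ))⁻¹ * (F.L : ℝ) = 1 / 18 := by
      rw [inv_mul_eq_div, div_eq_iff (by positivity)]; ring
    calc (4 * ((F.L : ℝ) ^ 3)⁻¹ + (18 * (F.L : ℝ))⁻¹) * (F.L : ℝ) = 4 * (((F.L : ℝ) ^ 3)⁻¹ * (F.L : ℝ)) + (18 * (F.L : ℝ))⁻¹ * (F.L : ℝ) := by ring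
      _ ≤ 4 * (1 / 9) + 1 / 18 := by rw [hB]; linarith
      _ = 1 / 2 := by norm_num
  have hM₀ : 0 ≤ ∑ b : PBond (F.P K) 0, ‖pertVar U₀ W b‖ ^ 2 := Finset.sum_nonneg fun _ _ => sq_nonneg _
  have hKD : 0 ≤ ((∑ x : Site (F.P K) 0, ∑ μ : Fin (F.P K).d, ∑ ν : Fin (F.P K).d,
            (if μ < ν then ∑ j : Fin 2, ∑ k : Fin 2,
              ‖(curl (torusT (F.P K) 0) (fun κ z => unitsField (toUField U₀) ⟨z, κ⟩) (fun κ z => pertVar U₀ W ⟨z, κ⟩) μ ν x) j k‖ ^ 2 else 0)) + (∑ x : Site (F.P K) 0, ∑ j : Fin 2, ∑ k : Fin 2,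
            ‖(divB (torusT (F.P K) 0) (fun κ z => unitsField (toUField U₀) ⟨z, κ⟩) (fun κ z => pertVar U₀ W ⟨z, κ⟩) x) j k‖ ^ 2)) := by positivity
  have hB : 0 ≤ 28800 * (F.L : ℝ) ^ 4 * ((∑ x : Site (F.P K) 0, ∑ μ : Fin (F.P K).d, ∑ ν : Fin (F.P K).d,
            (if μ < ν then ∑ j : Fin 2, ∑ k : Fin 2,
              ‖(curl (torusT (F.P K) 0) (fun κ z => unitsField (toUField U₀) ⟨z, κ⟩) (fun κ z => pertVar U₀ W ⟨z, κ⟩) μ ν x) j k‖ ^ 2 else 0)) + (∑ x : Site (F.P K) 0, ∑ j : Fin 2, ∑ k : Fin 2,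
            ‖(divB (torusT (F.P K) 0) (fun κ z => unitsField (toUField U₀) ⟨z, κ⟩) (fun κ z => pertVar U₀ W ⟨z, κ⟩) x) j k‖ ^ 2))
            + 600000 * (F.L : ℝ) ^ 4 * (((F.L : ℝ) ^ (K - n)) ^ 2)⁻¹ * (∑ b : PBond (F.P K) 0, ‖pertVar U₀ W b‖ ^ 2) := by positivity
  have hΦ0 : ∑ x : Site (F.P K) 0, ‖((frameAccU 0 (unitsField (toUField U₀)) (unitsField (toUField W)) x : (Matrix (Fin 2) (Fin 2) ℂ)ˣ) : Matrix (Fin 2) (Fin 2) ℂ) - 1‖ ^ 2 = 0 := by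
    simp [frameAccU_zero]
  have h := frameMass_induction (L := (F.L : ℝ)) (q := 4 * ((F.L : ℝ) ^ 3)⁻¹ + (18 * (F.L : ℝ))⁻¹) (C := 40 * (F.L : ℝ) ^ 2) (A := 7)
    (B := 28800 * (F.L : ℝ) ^ 4 * ((∑ x : Site (F.P K) 0, ∑ μ : Fin (F.P K).d, ∑ ν : Fin (F.P K).d,
            (if μ < ν then ∑ j : Fin 2, ∑ k : Fin 2,
              ‖(curl (torusT (F.P K) 0) (fun κ z => unitsField (toUField U₀) ⟨z, κ⟩) (fun κ z => pertVar U₀ W ⟨z, κ⟩) μ ν x) j k‖ ^ 2 else 0)) + (∑ x : Site (F.P K) 0, ∑ j : Fin 2, ∑ k : Fin 2,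
            ‖(divB (torusT (F.P K) 0) (fun κ z => unitsField (toUField U₀) ⟨z, κ⟩) (fun κ z => pertVar U₀ W ⟨z, κ⟩) x) j k‖ ^ 2))
            + 600000 * (F.L : ℝ) ^ 4 * (((F.L : ℝ) ^ (K - n)) ^ 2)⁻¹ * (∑ b : PBond (F.P K) 0, ‖pertVar U₀ W b‖ ^ 2))
    (M₀ := ∑ b : PBond (F.P K) 0, ‖pertVar U₀ W b‖ ^ 2)
    (by linarith) hq hqL (by positivity) (by norm_num) hB hM₀ (K - n)
    (fun l => ∑ x : Site (F.P K) l, ‖((frameAccU l (unitsField (toUField U₀)) (unitsField (toUField W)) x : (Matrix (Fin 2) (Fin 2) ℂ)ˣ) : Matrix (Fin 2) (Fin 2) ℂ) - 1‖ ^ 2)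
    (fun l => ∑ b : PBond (F.P K) l, ‖(pertVar (Averaging.iter (fun i => blockAvg (P := (F.P K)) (j := i) (expMeanLogSU (n := Fin 2))) l U₀) (Averaging.iter (fun i => blockAvg (P := (F.P K)) (j := i) (expMeanLogSU (n := Fin 2))) l W)) b‖ ^ 2)
    hΦ0 hΦ (fun l hl => by have := hM l hl; linarith)
  intro l hl
  have := h l hl
  linarith

/-- ★★ **THE ACCUMULATED SYMMETRIC FRAME MASSES UNDER (n3)'S BINDERS ALONE** — both (0.4) guards DISCHARGED by ✓px22 `small_iter_background_T3'`∕`small_iter_competitor_T3`.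
[cite: Balaban1985Averaging, (97) p.32, Prop. 3 (122)-(126) p.36; Balaban1984PropagatorsI, (1.18)-(1.20) pp.19-20] -/
theorem sum_normSq_frameAccU_sub_one_le_LOnly_T3 (U₀ W : GaugeField (F.P K) 0 (Matrix.specialUnitaryGroup (Fin 2) ℂ)) {ε : ℝ} (hε : 0 < ε) (hεL : 1000000 * (F.L : ℝ) ^ 5 * ε ≤ 1)
    (hU : ∀ p : Plaq (F.P K) 0, dist1 (GaugeField.plaqHol U₀ p) ≤ ε * (((F.L : ℝ) ^ (K - n)) ^ 2)⁻¹)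
    (μ : ℕ → ℝ) (hμ0 : ∀ j < K - n, 0 ≤ μ j)
    (hμ : ∀ j < K - n, ∀ c : PBond (F.P K) (j + 1), ((((F.P K).d + 2) * (F.P K).L : ℕ) : ℝ) * ∑ b ∈ (univ.filter (fun b : PBond (F.P K) j => blockOf b.src = c.src ∨ blockOf b.src = c.tgt)), ‖(pertVar (Averaging.iter (fun i => blockAvg (P := (F.P K)) (j := i) (expMeanLogSU (n := Fin 2))) j U₀) (Averaging.iter (fun i => blockAvg (P := (F.P K)) (j := i) (expMeanLogSU (n := Fin 2))) j W)) b‖ ≤ μ j)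
    (hμ72 : ∀ j < K - n, 72 * μ j ≤ 1) (hμN : ∀ j < K - n, 3 * μ j + 1 / 24 < deltaSU (Fin 2))
    {θ : ℝ} (hθ0 : 0 ≤ θ) (hμθ : ∀ j < K - n, 7800 * (F.L : ℝ) ^ 3 * (F.L : ℝ) ^ (K - n) * μ j ≤ θ * (F.L : ℝ) ^ j)
    (hθL : 1000 * θ * (F.L : ℝ) ≤ 1) :
    ∀ l ≤ K - n, ∑ x : Site (F.P K) l, ‖((frameAccU l (unitsField (toUField U₀)) (unitsField (toUField W)) x : (Matrix (Fin 2) (Fin 2) ℂ)ˣ) : Matrix (Fin 2) (Fin 2) ℂ) - 1‖ ^ 2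
      ≤ 2 * (F.L : ℝ) * (40 * (F.L : ℝ) ^ 2) * (7 * (∑ b : PBond (F.P K) 0, ‖pertVar U₀ W b‖ ^ 2) * ((F.L : ℝ) ^ l)⁻¹)
        + 40 * (F.L : ℝ) ^ 2 * ((28800 * (F.L : ℝ) ^ 4 * ((∑ x : Site (F.P K) 0, ∑ μ : Fin (F.P K).d, ∑ ν : Fin (F.P K).d,
            (if μ < ν then ∑ j : Fin 2, ∑ k : Fin 2,
              ‖(curl (torusT (F.P K) 0) (fun κ z => unitsField (toUField U₀) ⟨z, κ⟩) (fun κ z => pertVar U₀ W ⟨z, κ⟩) μ ν x) j k‖ ^ 2 else 0)) + (∑ x : Site (F.P K) 0, ∑ j : Fin 2, ∑ k : Fin 2,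
            ‖(divB (torusT (F.P K) 0) (fun κ z => unitsField (toUField U₀) ⟨z, κ⟩) (fun κ z => pertVar U₀ W ⟨z, κ⟩) x) j k‖ ^ 2))
            + 600000 * (F.L : ℝ) ^ 4 * (((F.L : ℝ) ^ (K - n)) ^ 2)⁻¹ * (∑ b : PBond (F.P K) 0, ‖pertVar U₀ W b‖ ^ 2)) * (F.L : ℝ) ^ l) :=
  sum_normSq_frameAccU_sub_one_le_LOnly_T3_of_guards F n K U₀ W hε hεL hU
    (small_iter_background_T3' F n K U₀ hε hεL hU) (small_iter_competitor_T3 F n K U₀ W hε hεL hU μ hμ0 hμ hμ72 hμN)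
    μ hμ0 hμ hμ72 hμN hθ0 hμθ hθL

/-! ## §2 At the Σ∕E2E datum -/

/-- ★★ **THE ACCUMULATED SYMMETRIC FRAME MASSES AT THE Σ∕E2E DATUM**: `W ∈ 𝔘_k(e)` (`RegPr F n K e W`), `D` Hermitian traceless with `‖D(b)‖ ≤ s`, `4s ≤ 1`, windows `10¹⁴L⁹e ≤ 1`,
`4·10¹¹L⁹(ℓs) ≤ 1` (✓px17 `chartSups`∕`supNumerals` VERBATIM); competitor `e^{iD}W = emb15 W (expHermField D)`; every `l ≤ K − n`.
[cite: Balaban1985Averaging, (97) p.32, Prop. 3 (122)-(126) p.36, Prop. 4 (134)-(135) p.38; Balaban1985Variational, (14)-(15) p.280, Prop. 7 p.299] -/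
theorem sum_normSq_frameAccU_sub_one_le_of_regPr {e s : ℝ} (he : 0 < e) (heL : 100000000000000 * (F.L : ℝ) ^ 9 * e ≤ 1)
    (hs0 : 0 ≤ s) (hs4 : 4 * s ≤ 1) (hsL : 400000000000 * (F.L : ℝ) ^ 9 * (((F.L : ℝ) ^ (K - n)) * s) ≤ 1)
    {W : GaugeField (F.P K) 0 (Matrix.specialUnitaryGroup (Fin 2) ℂ)} (hreg : RegPr F n K e W)
    (D : PBond (F.P K) 0 → Matrix (Fin 2) (Fin 2) ℂ) (hD : ∀ b : PBond (F.P K) 0, (D b).IsHermitian ∧ Matrix.trace (D b) = 0)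
    (hs : ∀ b : PBond (F.P K) 0, ‖D b‖ ≤ s) :
    ∀ l ≤ K - n, ∑ x : Site (F.P K) l, ‖((frameAccU l (unitsField (toUField W)) (unitsField (toUField (emb15 W (expHermField D)))) x : (Matrix (Fin 2) (Fin 2) ℂ)ˣ) : Matrix (Fin 2) (Fin 2) ℂ) - 1‖ ^ 2
      ≤ 2 * (F.L : ℝ) * (40 * (F.L : ℝ) ^ 2) * (7 * (∑ b : PBond (F.P K) 0, ‖pertVar W (emb15 W (expHermField D)) b‖ ^ 2) * ((F.L : ℝ) ^ l)⁻¹)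
        + 40 * (F.L : ℝ) ^ 2 * ((28800 * (F.L : ℝ) ^ 4 * ((∑ x : Site (F.P K) 0, ∑ μ : Fin (F.P K).d, ∑ ν : Fin (F.P K).d,
            (if μ < ν then ∑ j : Fin 2, ∑ k : Fin 2,
              ‖(curl (torusT (F.P K) 0) (fun κ z => unitsField (toUField W) ⟨z, κ⟩) (fun κ z => pertVar W (emb15 W (expHermField D)) ⟨z, κ⟩) μ ν x) j k‖ ^ 2 else 0)) + (∑ x : Site (F.P K) 0, ∑ j : Fin 2, ∑ k : Fin 2,
            ‖(divB (torusT (F.P K) 0) (fun κ z => unitsField (toUField W) ⟨z, κ⟩) (fun κ z => pertVar W (emb15 W (expHermField D)) ⟨z, κ⟩) x) j k‖ ^ 2))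
            + 600000 * (F.L : ℝ) ^ 4 * (((F.L : ℝ) ^ (K - n)) ^ 2)⁻¹ * (∑ b : PBond (F.P K) 0, ‖pertVar W (emb15 W (expHermField D)) b‖ ^ 2)) * (F.L : ℝ) ^ l) := by
  have heL' := window_weak F he heL
  have hUe := plaq_le_of_regPr F n K hreg
  obtain ⟨-, hμ⟩ := chartSups F n K he heL hs0 hs4 hsL hreg D hD hs
  obtain ⟨-, hμ0, hμ72, hμN, hμθ, hθ0, hθL⟩ := supNumerals F n K hs0 hsL
  exact sum_normSq_frameAccU_sub_one_le_LOnly_T3 F n K W (emb15 W (expHermField D)) he heL' hUe (fun j : ℕ => 480 * (F.L : ℝ) ^ 4 * (F.L : ℝ) ^ j * s) hμ0 hμ hμ72 hμN hθ0 hμθ hθL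

/-! ## §3 ★★★ The top level in the (β) door's letters: `frameTwS` -/

/-- ★★★ **THE TOP ACCUMULATED SYMMETRIC FRAME MASS `Φˢ_top = Σ_y ‖w_s(iD)(y) − 1‖²` IN THE `ℓ⁻¹M₀ + ℓ·KD` CURRENCY** (the symmetric half of the frame-ratio mass of the (β) row): at the
Σ∕E2E datum of §2, `Σ_{y : Site (F.P n) 0} ‖↑(frameTwS F n K h W (fun b ↦ I•D b) y) − 1‖² ≤ 560L³·M₀·ℓ⁻¹ + 40L²·(28800L⁴·KD + 600000L⁴·ℓ⁻²·M₀)·ℓ` (written as §2's right side at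
`l := K − n`), `ℓ = L^{K−n}` — §2 re-indexed along lit `siteShift (sites_eq F n K h) : Site (F.P n) 0 ≃ Site (F.P K) (K − n)` with `frameTwS_def` and ✓`unitsField_toUField_emb15_expHermField`.
[cite: Balaban1985Averaging, (82) p.30, (97) p.32, Prop. 3 (122)-(126) p.36; Balaban1985Variational, (14)-(15) p.280, (44) p.285; Balaban1987RG1, (0.4), (0.11) p.253] -/
theorem sum_normSq_frameTwS_sub_one_le_of_regPr (h : n ≤ K) {e s : ℝ} (he : 0 < e) (heL : 100000000000000 * (F.L : ℝ) ^ 9 * e ≤ 1)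
    (hs0 : 0 ≤ s) (hs4 : 4 * s ≤ 1) (hsL : 400000000000 * (F.L : ℝ) ^ 9 * (((F.L : ℝ) ^ (K - n)) * s) ≤ 1)
    {W : GaugeField (F.P K) 0 (Matrix.specialUnitaryGroup (Fin 2) ℂ)} (hreg : RegPr F n K e W)
    (D : PBond (F.P K) 0 → Matrix (Fin 2) (Fin 2) ℂ) (hD : ∀ b : PBond (F.P K) 0, (D b).IsHermitian ∧ Matrix.trace (D b) = 0)
    (hs : ∀ b : PBond (F.P K) 0, ‖D b‖ ≤ s) :
    ∑ y : Site (F.P n) 0, ‖((frameTwS F n K h W (fun b => Complex.I • D b) y : (Matrix (Fin 2) (Fin 2) ℂ)ˣ) : Matrix (Fin 2) (Fin 2) ℂ) - 1‖ ^ 2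
      ≤ 2 * (F.L : ℝ) * (40 * (F.L : ℝ) ^ 2) * (7 * (∑ b : PBond (F.P K) 0, ‖pertVar W (emb15 W (expHermField D)) b‖ ^ 2) * ((F.L : ℝ) ^ (K - n))⁻¹)
        + 40 * (F.L : ℝ) ^ 2 * ((28800 * (F.L : ℝ) ^ 4 * ((∑ x : Site (F.P K) 0, ∑ μ : Fin (F.P K).d, ∑ ν : Fin (F.P K).d,
            (if μ < ν then ∑ j : Fin 2, ∑ k : Fin 2,
              ‖(curl (torusT (F.P K) 0) (fun κ z => unitsField (toUField W) ⟨z, κ⟩) (fun κ z => pertVar W (emb15 W (expHermField D)) ⟨z, κ⟩) μ ν x) j k‖ ^ 2 else 0)) + (∑ x : Site (F.P K) 0, ∑ j : Fin 2, ∑ k : Fin 2,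
            ‖(divB (torusT (F.P K) 0) (fun κ z => unitsField (toUField W) ⟨z, κ⟩) (fun κ z => pertVar W (emb15 W (expHermField D)) ⟨z, κ⟩) x) j k‖ ^ 2))
            + 600000 * (F.L : ℝ) ^ 4 * (((F.L : ℝ) ^ (K - n)) ^ 2)⁻¹ * (∑ b : PBond (F.P K) 0, ‖pertVar W (emb15 W (expHermField D)) b‖ ^ 2)) * (F.L : ℝ) ^ (K - n)) := by
  have hfield : (fun b : PBond (F.P K) 0 => expUnit (Complex.I • D b) * bgUnits F K W b) = unitsField (toUField (emb15 W (expHermField D))) :=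
    (unitsField_toUField_emb15_expHermField (F := F) (K := K) W D hD).symm
  have hsum : ∑ y : Site (F.P n) 0, ‖((frameTwS F n K h W (fun b => Complex.I • D b) y : (Matrix (Fin 2) (Fin 2) ℂ)ˣ) : Matrix (Fin 2) (Fin 2) ℂ) - 1‖ ^ 2
      = ∑ x : Site (F.P K) (K - n), ‖((frameAccU (K - n) (unitsField (toUField W)) (unitsField (toUField (emb15 W (expHermField D)))) x : (Matrix (Fin 2) (Fin 2) ℂ)ˣ) : Matrix (Fin 2) (Fin 2) ℂ) - 1‖ ^ 2 := by
    refine Fintype.sum_equiv (siteShift (sites_eq F n K h)) _ _ fun y => ?_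
    rw [frameTwS_def, hfield]
    rfl
  rw [hsum]
  exact sum_normSq_frameAccU_sub_one_le_of_regPr F n K he heL hs0 hs4 hsL hreg D hD hs (K - n) le_rfl

end T3

end Summit.QuantumFields.YangMills.Theorems.Prop7SymFrameMassOfRegPr

end
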